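import Summits.AtomisticToContinuum.HydrodynamicLimit.Theorems.OneFlightGossipEngineEquilibriumStressVarianceDecayWindows
import Summits.AtomisticToContinuum.HydrodynamicLimit.Theorems.OneFlightGossipEngineEquilibriumStressVarianceDecayStatics
import Summits.AtomisticToContinuum.HydrodynamicLimit.Theorems.OneFlightGossipEngineEquilibriumStressVarianceDecayTruncation

/-!
# The core window estimate for the equilibrium kinetic shear stress (helper file 4/5 for
# `OneFlightGossipEngine.EquilibriumStressVarianceDecay`, stmt-AtomisticToContinuum-9531)

Frame of the item: homogeneous Gibbs law `G_N = localGibbsLaw σ c 0 θ N Φ` (constant activity `c ≥ 0`,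
zero drift, temperature `θ > 0`; a probability measure), a hard-sphere flow `Φ`, a continuous weight
`|φ| ≤ K`, and the item's functional
`Q_N(h) = (N+1)·∫⁻ ofReal(((N+1)⁻¹ Σᵢ h⁻¹∫₀ʰ φ(xᵢ(r)) v_{i,0}(r) v_{i,1}(r) dr)²) dG_N`.

* `core_bound` — for a truncation level `A > 0`, a reference window `h₀` at which the TRUNCATED
  observable `Σᵢ φ(xᵢ) t((vᵢ−0)/√θ)` (`t` the level-`A` truncation of `…Truncation`) has window variance `≤ δ(N+1)` (the output of
  `FastObservableMeanErgodic`), and any window `k h₀ ≤ h ≤ (k+1) h₀`: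
  `Q_N(h) ≤ θ²(4δ + 4K² E_γ|w|⁴/k² + 2K² E_γ|w|⁸/(2A)²)`.
  Steps: interchange `Σᵢ/∫₀ʰ` a.e. (integrable sections), `φ v₀v₁ = θ(φ·t∘ψ + φ·r∘ψ)` with
  `ψ(v) = (v − 0)/√θ`, `(a+b)² ≤ 2a² + 2b²`; main term by block sub-convexity (`…Windows`) + the
  hypothesis + weighted statics (`…Statics`); remainder by the ceiling (`…Windows`) + weighted statics +
  `∫ r² ≤ E|w|⁸/(2A)²` (`…Truncation`).
* `apriori_bound` — unconditionally, `Q_N(h) ≤ θ² K² E_γ|w|⁴` for every `N`, flow and `h > 0`: the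
  `(N+1)·` normalisation of the item is exactly critical (its `limsup_N` is finite for every window).
-/

noncomputable section

namespace Summit.AtomisticToContinuum.HydrodynamicLimit.Theorems

open MeasureTheory ProbabilityTheory Filter Topology Set
open Literature.Analysis.FluidPDE Literature.MathematicalPhysics.KineticTheory
open scoped InnerProductSpace ENNReal
open BoltzmannGreenKuboOrthMomentum BoltzmannGreenKuboForallN

namespace EquilibriumStressVarianceDecayC3

section Core

variable {σ : ℝ} {N : ℕ}

/-- Standardised truncation identity: `θ·(a·t((v−0)/√θ) + a·r((v−0)/√θ)) = a·v₀v₁` whenever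
`t + r = w₀w₁`. [folklore] -/
theorem theta_mul_truncation_eq {gA rA : V3 → ℝ} (hr : ∀ w, rA w = w 0 * w 1 - gA w)
    {θ : ℝ} (hθ : 0 < θ) (a : ℝ) (v : V3) :
    θ * (a * gA ((Real.sqrt θ)⁻¹ • (v - 0)) + a * rA ((Real.sqrt θ)⁻¹ • (v - 0))) = a * (v 0 * v 1) := by
  rw [← mul_add, trunc_add_rem hr, sub_zero]
  simp only [PiLp.smul_apply, smul_eq_mul]
  rw [show (Real.sqrt θ)⁻¹ * v 0 * ((Real.sqrt θ)⁻¹ * v 1) = (Real.sqrt θ ^ 2)⁻¹ * (v 0 * v 1) by ring,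
    Real.sq_sqrt hθ.le]
  field_simp

/-- `ℝ≥0∞` bookkeeping: `2 · ofReal x = ofReal (2x)`. [folklore] -/
theorem two_mul_ofReal (x : ℝ) : (2 : ℝ≥0∞) * ENNReal.ofReal x = ENNReal.ofReal (2 * x) := by
  rw [ENNReal.ofReal_mul (by norm_num : (0 : ℝ) ≤ 2), ENNReal.ofReal_ofNat]

/-- **Core estimate (one `N`, one flow, one window).** Under the homogeneous Gibbs law
`G_N = localGibbsLaw σ c 0 θ N Φ` (a probability measure, `c ≥ 0`, `θ > 0`), for continuous `|φ| ≤ K`,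
a truncation pair `(gA, rA)` at level `A > 0` (`…Truncation`), a reference window `h₀ > 0` at which the
truncated observable has window
variance `≤ δ(N+1)`, and any window `h` with `k h₀ ≤ h ≤ (k+1) h₀` (`k ≥ 1`):
`(N+1) · ∫⁻ ofReal(((N+1)⁻¹ Σᵢ h⁻¹∫₀ʰ φ(xᵢ(r)) v_{i,0}(r) v_{i,1}(r) dr)²) dG_N ≤
 ofReal(θ² (4δ + 4K² E|w|⁴ / k² + 2K² E|w|⁸/(2A)²))`. [folklore] -/
theorem core_bound {c θ : ℝ} (hc : 0 ≤ c) (hθ : 0 < θ)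
    (Φ : HardSphereFlow (Torus.geometry (Fin 3)) (hsDiameter σ N) (N + 1))
    [IsProbabilityMeasure (localGibbsLaw σ (fun _ => c) (fun _ => 0) (fun _ => θ) N Φ)]
    {φ : T3 → ℝ} (hφ : Continuous φ) {K : ℝ} (hK : ∀ x, |φ x| ≤ K)
    {A : ℝ} (hA : 0 < A) {gA rA : V3 → ℝ} (hg : ∀ w, gA w = w 0 * w 1 * (1 + ‖w‖ ^ 2 / A)⁻¹)
    (hr : ∀ w, rA w = w 0 * w 1 - gA w)
    {δ : ℝ} (hδ : 0 ≤ δ) {h₀ h : ℝ} (hh₀ : 0 < h₀) {k : ℕ} (hk : 1 ≤ k)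
    (hkh : (k : ℝ) * h₀ ≤ h) (hhk : h ≤ ((k : ℝ) + 1) * h₀)
    (hFOME : ∫⁻ z, ENNReal.ofReal ((h₀⁻¹ * ∫ s in (0 : ℝ)..h₀,
        ∑ i, φ (Φ.flow s z i).1 * gA ((Real.sqrt θ)⁻¹ • ((Φ.flow s z i).2 - 0))) ^ 2)
        ∂(localGibbsLaw σ (fun _ => c) (fun _ => 0) (fun _ => θ) N Φ) ≤ ENNReal.ofReal (δ * ((N : ℝ) + 1))) :
    ((N : ℝ≥0∞) + 1) * ∫⁻ z, ENNReal.ofReal ((((N : ℝ) + 1)⁻¹ * ∑ i : Fin (N + 1),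
        (h⁻¹ * ∫ r in (0 : ℝ)..h, φ ((Φ.flow r z i).1) * ((Φ.flow r z i).2 0 * (Φ.flow r z i).2 1))) ^ 2)
        ∂(localGibbsLaw σ (fun _ => c) (fun _ => 0) (fun _ => θ) N Φ) ≤
      ENNReal.ofReal (θ ^ 2 * (4 * δ + 4 * K ^ 2 * (∫ w : V3, ‖w‖ ^ 4 ∂stdGaussian V3) / (k : ℝ) ^ 2 +
        2 * K ^ 2 * ((∫ w : V3, ‖w‖ ^ 8 ∂stdGaussian V3) / (2 * A) ^ 2))) := by
  set G := localGibbsLaw σ (fun _ => c) (fun _ => 0) (fun _ => θ) N Φ with hGdef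
  set M₄ : ℝ := ∫ w : V3, ‖w‖ ^ 4 ∂stdGaussian V3 with hM₄
  set M₈ : ℝ := ∫ w : V3, ‖w‖ ^ 8 ∂stdGaussian V3 with hM₈
  set n : ℝ := (N : ℝ) + 1 with hn
  have hnpos : 0 < n := by positivity
  have hK0 : 0 ≤ K := (abs_nonneg _).trans (hK 0)
  have hM₄0 : 0 ≤ M₄ := integral_nonneg fun w => by positivity
  have hM₈0 : 0 ≤ M₈ := integral_nonneg fun w => by positivity
  have hkpos : (0 : ℝ) < k := by exact_mod_cast hk
  have hhpos : 0 < h := (mul_pos hkpos hh₀).trans_le hkh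
  -- the three phase functions
  set YA : V3 → ℝ := fun v => gA ((Real.sqrt θ)⁻¹ • (v - 0)) with hYA
  set YR : V3 → ℝ := fun v => rA ((Real.sqrt θ)⁻¹ • (v - 0)) with hYR
  set Y0 : V3 → ℝ := fun v => v 0 * v 1 with hY0
  set XA : Config (N + 1) (Fin 3) T3 → ℝ := fun w => ∑ i, φ (w i).1 * YA (w i).2 with hXA
  set XR : Config (N + 1) (Fin 3) T3 → ℝ := fun w => ∑ i, φ (w i).1 * YR (w i).2 with hXR
  set Xi : Fin (N + 1) → Config (N + 1) (Fin 3) T3 → ℝ := fun i w => φ (w i).1 * Y0 (w i).2 with hXi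
  have hψm : Measurable fun v : V3 => (Real.sqrt θ)⁻¹ • (v - 0) := by fun_prop
  have hYAm : Measurable YA := (continuous_trunc hA hg).measurable.comp hψm
  have hYRm : Measurable YR := (continuous_rem hA hg hr).measurable.comp hψm
  have hY0m : Measurable Y0 := by rw [hY0]; fun_prop
  have hYA2 : MemLp YA 2 (gaussMeasure 0 θ) :=
    (standardize_gaussMeasure hθ 0 (continuous_trunc hA hg).measurable).2 (memLp_trunc hA hg)
  have hYR2 : MemLp YR 2 (gaussMeasure 0 θ) :=
    (standardize_gaussMeasure hθ 0 (continuous_rem hA hg hr).measurable).2 (memLp_rem hA hg hr)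
  have hY0eq : Y0 = fun v => θ * (1 * YA v + 1 * YR v) := by
    funext v
    rw [hY0, hYA, hYR]
    simp only []
    rw [theta_mul_truncation_eq hr hθ 1 v, one_mul]
  have hY02 : MemLp Y0 2 (gaussMeasure 0 θ) := by
    rw [hY0eq]
    exact ((hYA2.const_mul 1).add (hYR2.const_mul 1)).const_mul θ
  obtain ⟨hXAm, hXA2⟩ := memLp_weighted_sum hc hθ 0 Φ hYAm hYA2 hφ hK
  obtain ⟨hXRm, hXR2⟩ := memLp_weighted_sum hc hθ 0 Φ hYRm hYR2 hφ hK
  have hXi2 : ∀ i, MemLp (Xi i) 2 G := fun i => memLp_weighted hc hθ 0 Φ hY0m hY02 hφ hK i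
  have hXim : ∀ i, Measurable (Xi i) := fun i =>
    (hφ.measurable.comp (measurable_pi_apply i).fst).mul (hY0m.comp (measurable_pi_apply i).snd)
  -- pointwise identity `Σᵢ Xi = θ (XA + XR)`
  have hsum : ∀ w, ∑ i, Xi i w = θ * (XA w + XR w) := by
    intro w
    rw [hXA, hXR]
    simp only []
    rw [← Finset.sum_add_distrib, Finset.mul_sum]
    refine Finset.sum_congr rfl fun i _ => ?_
    rw [hXi, hY0, hYA, hYR]
    exact (theta_mul_truncation_eq hr hθ (φ (w i).1) (w i).2).symm
  -- a.e. integrable sections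
  have hsecA : ∀ᵐ z ∂G, IntegrableOn (fun r => XA (Φ.flow r z)) (Ioc (0 : ℝ) h) :=
    (integrable_comp_flow_prod c θ 0 Φ hXAm (hXA2.integrable one_le_two) h).prod_left_ae
  have hsecR : ∀ᵐ z ∂G, IntegrableOn (fun r => XR (Φ.flow r z)) (Ioc (0 : ℝ) h) :=
    (integrable_comp_flow_prod c θ 0 Φ hXRm (hXR2.integrable one_le_two) h).prod_left_ae
  have hseci : ∀ᵐ z ∂G, ∀ i, IntegrableOn (fun r => Xi i (Φ.flow r z)) (Ioc (0 : ℝ) h) := by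
    rw [ae_all_iff]
    exact fun i => (integrable_comp_flow_prod c θ 0 Φ (hXim i) ((hXi2 i).integrable one_le_two) h).prod_left_ae
  -- the pointwise bound
  set κ : ℝ := (n⁻¹ * θ) ^ 2 with hκ
  have hpt : ∀ᵐ z ∂G, ENNReal.ofReal ((n⁻¹ * ∑ i : Fin (N + 1),
        (h⁻¹ * ∫ r in (0 : ℝ)..h, φ ((Φ.flow r z i).1) * ((Φ.flow r z i).2 0 * (Φ.flow r z i).2 1))) ^ 2) ≤
      ENNReal.ofReal (2 * κ) * ENNReal.ofReal ((h⁻¹ * ∫ r in (0 : ℝ)..h, XA (Φ.flow r z)) ^ 2) +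
        ENNReal.ofReal (2 * κ) * ENNReal.ofReal ((h⁻¹ * ∫ r in (0 : ℝ)..h, XR (Φ.flow r z)) ^ 2) := by
    filter_upwards [hsecA, hsecR, hseci] with z hzA hzR hzi
    have hiA : IntervalIntegrable (fun r => XA (Φ.flow r z)) volume 0 h :=
      (intervalIntegrable_iff_integrableOn_Ioc_of_le hhpos.le).2 hzA
    have hiR : IntervalIntegrable (fun r => XR (Φ.flow r z)) volume 0 h :=
      (intervalIntegrable_iff_integrableOn_Ioc_of_le hhpos.le).2 hzR
    have hii : ∀ i ∈ (Finset.univ : Finset (Fin (N + 1))), IntervalIntegrable (fun r => Xi i (Φ.flow r z)) volume 0 h :=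
      fun i _ => (intervalIntegrable_iff_integrableOn_Ioc_of_le hhpos.le).2 (hzi i)
    have e1 : ∑ i : Fin (N + 1), (h⁻¹ * ∫ r in (0 : ℝ)..h, φ ((Φ.flow r z i).1) * ((Φ.flow r z i).2 0 * (Φ.flow r z i).2 1)) =
        h⁻¹ * (θ * ((∫ r in (0 : ℝ)..h, XA (Φ.flow r z)) + ∫ r in (0 : ℝ)..h, XR (Φ.flow r z))) := by
      rw [← Finset.mul_sum, ← intervalIntegral.integral_finsetSum hii]
      congr 1
      rw [← intervalIntegral.integral_add hiA hiR, ← intervalIntegral.integral_const_mul]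
      refine intervalIntegral.integral_congr fun r _ => ?_
      exact hsum (Φ.flow r z)
    rw [e1]
    set a := h⁻¹ * ∫ r in (0 : ℝ)..h, XA (Φ.flow r z)
    set b := h⁻¹ * ∫ r in (0 : ℝ)..h, XR (Φ.flow r z)
    have e2 : (n⁻¹ * (h⁻¹ * (θ * ((∫ r in (0 : ℝ)..h, XA (Φ.flow r z)) + ∫ r in (0 : ℝ)..h, XR (Φ.flow r z))))) ^ 2 =
        κ * (a + b) ^ 2 := by
      rw [hκ]; ring
    rw [e2, ← ENNReal.ofReal_mul (by positivity), ← ENNReal.ofReal_mul (by positivity),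
      ← ENNReal.ofReal_add (by positivity) (by positivity)]
    refine ENNReal.ofReal_le_ofReal ?_
    nlinarith [sq_nonneg (a - b), sq_nonneg (n⁻¹ * θ)]
  -- a.e.-measurability of the two window functionals
  have hwA : AEMeasurable (fun z => ENNReal.ofReal ((h⁻¹ * ∫ r in (0 : ℝ)..h, XA (Φ.flow r z)) ^ 2)) G :=
    (((aemeasurable_window c θ 0 Φ hXAm (hXA2.integrable one_le_two) hhpos.le).const_mul h⁻¹).pow_const 2).ennreal_ofReal
  -- integrate
  have hint : ∫⁻ z, ENNReal.ofReal ((n⁻¹ * ∑ i : Fin (N + 1),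
        (h⁻¹ * ∫ r in (0 : ℝ)..h, φ ((Φ.flow r z i).1) * ((Φ.flow r z i).2 0 * (Φ.flow r z i).2 1))) ^ 2) ∂G ≤
      ENNReal.ofReal (2 * κ) * ∫⁻ z, ENNReal.ofReal ((h⁻¹ * ∫ r in (0 : ℝ)..h, XA (Φ.flow r z)) ^ 2) ∂G +
        ENNReal.ofReal (2 * κ) * ∫⁻ z, ENNReal.ofReal ((h⁻¹ * ∫ r in (0 : ℝ)..h, XR (Φ.flow r z)) ^ 2) ∂G := by
    refine (lintegral_mono_ae hpt).trans (le_of_eq ?_)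
    rw [lintegral_add_left' (hwA.const_mul _), lintegral_const_mul' _ _ ENNReal.ofReal_ne_top,
      lintegral_const_mul' _ _ ENNReal.ofReal_ne_top]
  -- the main term: block sub-convexity + FOME + statics
  have hSA : ∫⁻ z, ENNReal.ofReal (XA z ^ 2) ∂G ≤ ENNReal.ofReal (n * (K ^ 2 * M₄)) := by
    refine (lintegral_sq_sum_weighted_le hc hθ 0 Φ (continuous_trunc hA hg).measurable (memLp_trunc hA hg)
      (integral_trunc hg) hφ hK).trans (ENNReal.ofReal_le_ofReal ?_)
    exact mul_le_mul_of_nonneg_left (mul_le_mul_of_nonneg_left (integral_trunc_sq_le hA hg) (sq_nonneg _)) hnpos.le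
  have hWA : ∫⁻ z, ENNReal.ofReal ((h⁻¹ * ∫ r in (0 : ℝ)..h, XA (Φ.flow r z)) ^ 2) ∂G ≤
      ENNReal.ofReal (2 * (δ * n) + 2 / (k : ℝ) ^ 2 * (n * (K ^ 2 * M₄))) := by
    refine (lintegral_sq_window_le_of_le_of_le c θ 0 Φ hXAm hXA2 hh₀ hk hkh hhk).trans ?_
    rw [ENNReal.ofReal_add (by positivity) (by positivity), ← two_mul_ofReal,
      ENNReal.ofReal_mul (by positivity : (0 : ℝ) ≤ 2 / (k : ℝ) ^ 2)]
    exact add_le_add (mul_le_mul' le_rfl hFOME) (mul_le_mul' le_rfl hSA)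
  -- the remainder: ceiling + statics
  have hWR : ∫⁻ z, ENNReal.ofReal ((h⁻¹ * ∫ r in (0 : ℝ)..h, XR (Φ.flow r z)) ^ 2) ∂G ≤
      ENNReal.ofReal (n * (K ^ 2 * (M₈ / (2 * A) ^ 2))) := by
    refine (lintegral_sq_window_le c θ 0 Φ hXRm hXR2 hhpos).trans ?_
    refine (lintegral_sq_sum_weighted_le hc hθ 0 Φ (continuous_rem hA hg hr).measurable (memLp_rem hA hg hr)
      (integral_rem hg hr) hφ hK).trans (ENNReal.ofReal_le_ofReal ?_)
    exact mul_le_mul_of_nonneg_left (mul_le_mul_of_nonneg_left (integral_rem_sq_le hA hg hr) (sq_nonneg _)) hnpos.le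
  -- assemble
  have hcast : ((N : ℝ≥0∞) + 1) = ENNReal.ofReal n := by
    rw [hn, ENNReal.ofReal_add (by positivity) zero_le_one, ENNReal.ofReal_natCast, ENNReal.ofReal_one]
  calc ((N : ℝ≥0∞) + 1) * ∫⁻ z, ENNReal.ofReal ((n⁻¹ * ∑ i : Fin (N + 1),
          (h⁻¹ * ∫ r in (0 : ℝ)..h, φ ((Φ.flow r z i).1) * ((Φ.flow r z i).2 0 * (Φ.flow r z i).2 1))) ^ 2) ∂G
      ≤ ENNReal.ofReal n * (ENNReal.ofReal (2 * κ) * ENNReal.ofReal (2 * (δ * n) + 2 / (k : ℝ) ^ 2 * (n * (K ^ 2 * M₄))) +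
          ENNReal.ofReal (2 * κ) * ENNReal.ofReal (n * (K ^ 2 * (M₈ / (2 * A) ^ 2)))) := by
        rw [hcast]
        exact mul_le_mul' le_rfl (hint.trans (add_le_add (mul_le_mul' le_rfl hWA) (mul_le_mul' le_rfl hWR)))
    _ = ENNReal.ofReal (n * (2 * κ * (2 * (δ * n) + 2 / (k : ℝ) ^ 2 * (n * (K ^ 2 * M₄))) +
          2 * κ * (n * (K ^ 2 * (M₈ / (2 * A) ^ 2))))) := by
        rw [← ENNReal.ofReal_mul (by positivity), ← ENNReal.ofReal_mul (by positivity),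
          ← ENNReal.ofReal_add (by positivity) (by positivity), ← ENNReal.ofReal_mul (by positivity)]
    _ = ENNReal.ofReal (θ ^ 2 * (4 * δ + 4 * K ^ 2 * M₄ / (k : ℝ) ^ 2 + 2 * K ^ 2 * (M₈ / (2 * A) ^ 2))) := by
        congr 1
        rw [hκ]
        field_simp
        ring

/-- The shear-stress germ `ĝ(w) = w₀ w₁` is odd under `w₀ ↦ −w₀`. [folklore] -/
theorem shear_reflB_zero (w : V3) : (reflB 0 w) 0 * (reflB 0 w) 1 = -(w 0 * w 1) := by
  simp only [reflB_apply]
  simp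

/-- **A-priori bound (every `N`, every flow, every window `h > 0`): the `(N+1)·` normalisation of
`EquilibriumStressVarianceDecay` is exactly critical.** Under the homogeneous Gibbs law,
`(N+1)·∫⁻ ofReal(((N+1)⁻¹ Σᵢ h⁻¹∫₀ʰ φ(xᵢ(r)) v_{i,0}(r) v_{i,1}(r) dr)²) dG_N ≤ θ² K² E_γ|w|⁴` for
`|φ| ≤ K` (Jensen in time + invariance + weighted statics; so `limsup_N` in the item is finite for every
`τ`, and the item is purely the `τ → ∞` decay). [folklore] -/
theorem apriori_bound {c θ : ℝ} (hc : 0 ≤ c) (hθ : 0 < θ)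
    (Φ : HardSphereFlow (Torus.geometry (Fin 3)) (hsDiameter σ N) (N + 1))
    [IsProbabilityMeasure (localGibbsLaw σ (fun _ => c) (fun _ => 0) (fun _ => θ) N Φ)]
    {φ : T3 → ℝ} (hφ : Continuous φ) {K : ℝ} (hK : ∀ x, |φ x| ≤ K) {h : ℝ} (hh : 0 < h) :
    ((N : ℝ≥0∞) + 1) * ∫⁻ z, ENNReal.ofReal ((((N : ℝ) + 1)⁻¹ * ∑ i : Fin (N + 1),
        (h⁻¹ * ∫ r in (0 : ℝ)..h, φ ((Φ.flow r z i).1) * ((Φ.flow r z i).2 0 * (Φ.flow r z i).2 1))) ^ 2)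
        ∂(localGibbsLaw σ (fun _ => c) (fun _ => 0) (fun _ => θ) N Φ) ≤
      ENNReal.ofReal (θ ^ 2 * (K ^ 2 * ∫ w : V3, ‖w‖ ^ 4 ∂stdGaussian V3)) := by
  set G := localGibbsLaw σ (fun _ => c) (fun _ => 0) (fun _ => θ) N Φ with hGdef
  set n : ℝ := (N : ℝ) + 1 with hn
  have hnpos : 0 < n := by positivity
  have hK0 : 0 ≤ K := (abs_nonneg _).trans (hK 0)
  -- the germ `ĝ = w₀w₁` and the phase functions
  set gs : V3 → ℝ := fun w => w 0 * w 1 with hgs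
  have hgsc : Continuous gs := by rw [hgs]; fun_prop
  obtain ⟨g1, r1, hg1, hr1⟩ := exists_trunc_rem (1 : ℝ)
  have hgs_eq : gs = fun w => g1 w + r1 w := by funext w; rw [trunc_add_rem hr1]
  have hgs2 : MemLp gs 2 (stdGaussian V3) := by
    rw [hgs_eq]; exact (memLp_trunc one_pos hg1).add (memLp_rem one_pos hg1 hr1)
  have hgs0 : ∫ w, gs w ∂stdGaussian V3 = 0 :=
    integral_stdGaussian_eq_zero_of_odd (reflB 0) (G := gs) shear_reflB_zero
  have hgs_sq : ∫ w, gs w ^ 2 ∂stdGaussian V3 ≤ ∫ w : V3, ‖w‖ ^ 4 ∂stdGaussian V3 := by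
    refine integral_mono hgs2.integrable_sq integrable_norm_pow_four_stdGaussian fun w => ?_
    have h1 := abs_coord_mul_coord_le w
    have h2 : gs w ^ 2 ≤ (‖w‖ ^ 2 / 2) ^ 2 := by
      rw [← sq_abs]; exact pow_le_pow_left₀ (abs_nonneg _) h1 2
    calc gs w ^ 2 ≤ (‖w‖ ^ 2 / 2) ^ 2 := h2
      _ ≤ ‖w‖ ^ 4 := by nlinarith [sq_nonneg (‖w‖ ^ 2)]
  set Ys : V3 → ℝ := fun v => gs ((Real.sqrt θ)⁻¹ • (v - 0)) with hYs
  set Y0 : V3 → ℝ := fun v => v 0 * v 1 with hY0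
  set Xs : Config (N + 1) (Fin 3) T3 → ℝ := fun w => ∑ i, φ (w i).1 * Ys (w i).2 with hXs
  set Xi : Fin (N + 1) → Config (N + 1) (Fin 3) T3 → ℝ := fun i w => φ (w i).1 * Y0 (w i).2 with hXi
  have hψm : Measurable fun v : V3 => (Real.sqrt θ)⁻¹ • (v - 0) := by fun_prop
  have hYsm : Measurable Ys := hgsc.measurable.comp hψm
  have hY0m : Measurable Y0 := by rw [hY0]; fun_prop
  have hYs2 : MemLp Ys 2 (gaussMeasure 0 θ) := (standardize_gaussMeasure hθ 0 hgsc.measurable).2 hgs2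
  have hpt0 : ∀ (a : ℝ) (v : V3), a * Y0 v = θ * (a * Ys v) := by
    intro a v
    have h := theta_mul_truncation_eq hr1 hθ a v
    rw [← mul_add] at h
    rw [hY0, hYs, hgs_eq]
    exact h.symm
  have hY0eq : Y0 = fun v => θ * (1 * Ys v) := by
    funext v; have := hpt0 1 v; rwa [one_mul] at this
  have hY02 : MemLp Y0 2 (gaussMeasure 0 θ) := by
    rw [hY0eq]; exact (hYs2.const_mul 1).const_mul θ
  obtain ⟨hXsm, hXs2⟩ := memLp_weighted_sum hc hθ 0 Φ hYsm hYs2 hφ hK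
  have hXi2 : ∀ i, MemLp (Xi i) 2 G := fun i => memLp_weighted hc hθ 0 Φ hY0m hY02 hφ hK i
  have hXim : ∀ i, Measurable (Xi i) := fun i =>
    (hφ.measurable.comp (measurable_pi_apply i).fst).mul (hY0m.comp (measurable_pi_apply i).snd)
  have hsum : ∀ w, ∑ i, Xi i w = θ * Xs w := by
    intro w
    rw [hXs]
    simp only []
    rw [Finset.mul_sum]
    exact Finset.sum_congr rfl fun i _ => hpt0 (φ (w i).1) (w i).2
  have hsecs : ∀ᵐ z ∂G, IntegrableOn (fun r => Xs (Φ.flow r z)) (Ioc (0 : ℝ) h) :=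
    (integrable_comp_flow_prod c θ 0 Φ hXsm (hXs2.integrable one_le_two) h).prod_left_ae
  have hseci : ∀ᵐ z ∂G, ∀ i, IntegrableOn (fun r => Xi i (Φ.flow r z)) (Ioc (0 : ℝ) h) := by
    rw [ae_all_iff]
    exact fun i => (integrable_comp_flow_prod c θ 0 Φ (hXim i) ((hXi2 i).integrable one_le_two) h).prod_left_ae
  set κ : ℝ := (n⁻¹ * θ) ^ 2 with hκ
  have hpt : ∀ᵐ z ∂G, ENNReal.ofReal ((n⁻¹ * ∑ i : Fin (N + 1),
        (h⁻¹ * ∫ r in (0 : ℝ)..h, φ ((Φ.flow r z i).1) * ((Φ.flow r z i).2 0 * (Φ.flow r z i).2 1))) ^ 2) =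
      ENNReal.ofReal κ * ENNReal.ofReal ((h⁻¹ * ∫ r in (0 : ℝ)..h, Xs (Φ.flow r z)) ^ 2) := by
    filter_upwards [hsecs, hseci] with z hzs hzi
    have hii : ∀ i ∈ (Finset.univ : Finset (Fin (N + 1))), IntervalIntegrable (fun r => Xi i (Φ.flow r z)) volume 0 h :=
      fun i _ => (intervalIntegrable_iff_integrableOn_Ioc_of_le hh.le).2 (hzi i)
    have e1 : ∑ i : Fin (N + 1), (h⁻¹ * ∫ r in (0 : ℝ)..h, φ ((Φ.flow r z i).1) * ((Φ.flow r z i).2 0 * (Φ.flow r z i).2 1)) =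
        h⁻¹ * (θ * ∫ r in (0 : ℝ)..h, Xs (Φ.flow r z)) := by
      rw [← Finset.mul_sum, ← intervalIntegral.integral_finsetSum hii]
      congr 1
      rw [← intervalIntegral.integral_const_mul]
      refine intervalIntegral.integral_congr fun r _ => ?_
      exact hsum (Φ.flow r z)
    rw [e1, ← ENNReal.ofReal_mul (by positivity)]
    congr 1
    rw [hκ]; ring
  have hS : ∫⁻ z, ENNReal.ofReal (Xs z ^ 2) ∂G ≤ ENNReal.ofReal (n * (K ^ 2 * ∫ w : V3, ‖w‖ ^ 4 ∂stdGaussian V3)) := by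
    refine (lintegral_sq_sum_weighted_le hc hθ 0 Φ hgsc.measurable hgs2 hgs0 hφ hK).trans
      (ENNReal.ofReal_le_ofReal ?_)
    exact mul_le_mul_of_nonneg_left (mul_le_mul_of_nonneg_left hgs_sq (sq_nonneg _)) hnpos.le
  have hcast : ((N : ℝ≥0∞) + 1) = ENNReal.ofReal n := by
    rw [hn, ENNReal.ofReal_add (by positivity) zero_le_one, ENNReal.ofReal_natCast, ENNReal.ofReal_one]
  rw [hcast, lintegral_congr_ae hpt, lintegral_const_mul' _ _ ENNReal.ofReal_ne_top]
  calc ENNReal.ofReal n * (ENNReal.ofReal κ * ∫⁻ z, ENNReal.ofReal ((h⁻¹ * ∫ r in (0 : ℝ)..h, Xs (Φ.flow r z)) ^ 2) ∂G)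
      ≤ ENNReal.ofReal n * (ENNReal.ofReal κ * ENNReal.ofReal (n * (K ^ 2 * ∫ w : V3, ‖w‖ ^ 4 ∂stdGaussian V3))) :=
        mul_le_mul' le_rfl (mul_le_mul' le_rfl ((lintegral_sq_window_le c θ 0 Φ hXsm hXs2 hh).trans hS))
    _ = ENNReal.ofReal (θ ^ 2 * (K ^ 2 * ∫ w : V3, ‖w‖ ^ 4 ∂stdGaussian V3)) := by
        rw [← ENNReal.ofReal_mul (by positivity), ← ENNReal.ofReal_mul (by positivity)]
        congr 1
        rw [hκ]; field_simp

end Core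

end EquilibriumStressVarianceDecayC3

end Summit.AtomisticToContinuum.HydrodynamicLimit.Theorems

end
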